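import Summits.CriticalPhenomena.PercolationContinuityZ3.Theorems.PercNearOneGluingNoHeavyLowerTailKnQuestion8CoefficientwiseTrivialCoreFlip
import HarnessLib

/-!
# The core-class kernel: CW-PA for `N(x) = N(z) = {a, b}` reduces to an inequality on the middle graph, proved here for supermodular `f`

Support file (`--supports stmt-CriticalPhenomena-4575`, closed), prover `prim-cplus-coupling` (gen 29).  No definitions, no notations, no named facts,
no sorries; standard axioms.  Memo `prim-cplus-coupling/A5-COUPLING-gen29.md` §3.4.

Context.  prim-lf-2's reduction of the coefficientwise first rung CW-PA (memo `prim-lf-2/CW-VDBHK-gen29.md` §4.4) ends in the CORE CLASS: two-terminal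
multigraphs `G` whose terminals `x, z` have the same neighbourhood `N`.  For `N = {a, b}` (single edges `xa, xb, za, zb`; middle graph `H = G − x − z`
arbitrary) peeling both terminals gives the exact identity (memo §3.4; `R_v = C_v(ω)`, `B_v = C_v(E∖ω)` the red / blue clusters IN `H`, `T_H(a,b)` the wall
event 'no monochromatic `a–b` path in `H`', `f_H(S) = f({x} ∪ S) − f({x})`, `g_H(S) = g({x} ∪ S)`):
  `Σ_{T(G)} f(K)(g(K) − g(L)) = 2·[ Σ_{ω ⊆ E(H)} f_H(R_a ∪ R_b)(g_H(R_a ∪ R_b) − g_H(∅))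
                                     + Σ_{ω ∈ T_H(a,b)} ( f_H(R_a)(g_H(R_a) − g_H(B_b)) + f_H(R_b)(g_H(R_b) − g_H(B_a)) ) ]`
— a Harris-type sum on `H` plus an 'anti-GRAND' correlation of `(C_a^red, C_b^blue)` under the wall event of `(H; a, b)`.
* `Coefficientwise.coreClass_kernel_nonneg` — **the bracket is `≥ 0` for every finite multigraph `H`, all `a, b`, every monotone SUPERMODULAR `f` with
  `f ∅ = 0` and every monotone `g`.**  Proof: on `T_H(a,b)` the red clusters of `a` and `b` are disjoint, so supermodularity gives `f(R_a) + f(R_b) ≤ f(R_a ∪ R_b)`;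
  each anti term is `≥ −f(R_•)·(g(B_a ∪ B_b) − g ∅)`, hence the anti sum is `≥ −Σ_ω f(R_N(ω))·(g(R_N(E∖ω)) − g ∅)`, which the Harris sum dominates by
  Harris' inequality in two-colouring form (`harris_twoColouring_subpowerset`).
Consequence (with the identity): in the core class `N(x) = N(z) = {a,b}`, `Σ_T f(K)(g(K) − g(L)) ≥ 0` for all monotone supermodular `f` (in particular all
principal filters `f = 1[S ⊆ ·]`, so the count-one Bernstein coefficients of van den Berg–Kahn's Theorem 1.1 `P(s↔A, s↔B | s↮t) ≥ P(s↔A | s↮t)P(s↔B | s↮t)`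
are `≥ 0` on this class) and all monotone `g`.  Exact census (coreclass2.py / core2_check.py): the same lower bound holds for union indicators too (10⁶ tests, 0 failures),
where the supermodular step is unavailable.
[cite: KozmaNitzan2024, Questions 8–9 (§5.5 p. 36) (context: the Question-8 pocket covariance programme)]
-/

namespace Summit.CriticalPhenomena.PercolationContinuityZ3.Theorems

open Finset Literature.Probability.Percolation

namespace Coefficientwise

variable {ι V : Type*}

open Classical in
/-- **Core-class kernel.**  For a finite multigraph (`ends`, edge set `E`), vertices `a, b`, a monotone supermodular `f : Set V → ℝ` with `f ∅ = 0` and a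
monotone `g`, writing `R_v(ω) = C_v(ω)` and `B_v(ω) = C_v(E ∖ ω)`:
`0 ≤ Σ_{ω ⊆ E} f(R_a ∪ R_b)(g(R_a ∪ R_b) − g ∅) + Σ_{ω ⊆ E : b ∉ R_a, b ∉ B_a} [f(R_a)(g(R_a) − g(B_b)) + f(R_b)(g(R_b) − g(B_a))]`.
[cite: KozmaNitzan2024, Questions 8–9 (§5.5 p. 36) (context)] -/
theorem coreClass_kernel_nonneg [DecidableEq ι] (ends : ι → Sym2 V) (E : Finset ι) (a b : V) (f g : Set V → ℝ)
    (hf : Monotone f) (hfs : ∀ P Q : Set V, f P + f Q ≤ f (P ∪ Q) + f (P ∩ Q)) (hf0 : f ∅ = 0) (hg : Monotone g) :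
    0 ≤ (∑ ω ∈ E.powerset,
        f (openCluster (ends '' (↑ω : Set ι)) a ∪ openCluster (ends '' (↑ω : Set ι)) b) *
          (g (openCluster (ends '' (↑ω : Set ι)) a ∪ openCluster (ends '' (↑ω : Set ι)) b) - g ∅))
      + ∑ ω ∈ E.powerset.filter (fun ω : Finset ι => b ∉ openCluster (ends '' (↑ω : Set ι)) a ∧ b ∉ openCluster (ends '' (↑(E \ ω) : Set ι)) a),
        (f (openCluster (ends '' (↑ω : Set ι)) a) * (g (openCluster (ends '' (↑ω : Set ι)) a) - g (openCluster (ends '' (↑(E \ ω) : Set ι)) b))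
          + f (openCluster (ends '' (↑ω : Set ι)) b) * (g (openCluster (ends '' (↑ω : Set ι)) b) - g (openCluster (ends '' (↑(E \ ω) : Set ι)) a))) := by
  -- notation-free abbreviations
  set C : Finset ι → V → Set V := fun ω v => openCluster (ends '' (↑ω : Set ι)) v with hC
  set P : Finset ι → ℝ := fun ω => f (C ω a ∪ C ω b) with hP
  set Gn : Finset ι → ℝ := fun ω => g (C ω a ∪ C ω b) - g ∅ with hGn
  set D : Finset (Finset ι) := E.powerset.filter (fun ω => b ∉ C ω a ∧ b ∉ C (E \ ω) a) with hD
  change 0 ≤ (∑ ω ∈ E.powerset, P ω * Gn ω) +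
    ∑ ω ∈ D, (f (C ω a) * (g (C ω a) - g (C (E \ ω) b)) + f (C ω b) * (g (C ω b) - g (C (E \ ω) a)))
  have hCmono : ∀ {ω ω' : Finset ι} (v : V), ω ⊆ ω' → C ω v ⊆ C ω' v := fun v h => openCluster_image_mono ends h v
  have hf_nonneg : ∀ S : Set V, 0 ≤ f S := fun S => by rw [← hf0]; exact hf (Set.empty_subset S)
  have hPm : Monotone P := fun ω ω' h => hf (Set.union_subset_union (hCmono a h) (hCmono b h))
  have hGm : Monotone Gn := fun ω ω' h => by
    simp only [hGn]; linarith [hg (Set.union_subset_union (hCmono a h) (hCmono b h))]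
  have hP0 : ∀ ω, 0 ≤ P ω := fun ω => hf_nonneg _
  have hG0 : ∀ ω, 0 ≤ Gn ω := fun ω => by simp only [hGn]; linarith [hg (Set.empty_subset (C ω a ∪ C ω b))]
  -- (1) Harris in two-colouring form: Σ P·Gn ≥ Σ P·(Gn ∘ complement)
  have h1 : ∑ ω ∈ E.powerset, P ω * Gn (E \ ω) ≤ ∑ ω ∈ E.powerset, P ω * Gn ω := by
    have key := harris_twoColouring_subpowerset E P Gn hPm hGm
    have e1 : ∑ ω ∈ E.powerset, (P ω - P (E \ ω)) * (Gn ω - Gn (E \ ω)) =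
        (∑ ω ∈ E.powerset, P ω * Gn ω) + (∑ ω ∈ E.powerset, P (E \ ω) * Gn (E \ ω))
          - (∑ ω ∈ E.powerset, P ω * Gn (E \ ω)) - (∑ ω ∈ E.powerset, P (E \ ω) * Gn ω) := by
      rw [← Finset.sum_add_distrib, ← Finset.sum_sub_distrib, ← Finset.sum_sub_distrib]
      refine Finset.sum_congr rfl fun ω _ => by ring
    have e2 : ∑ ω ∈ E.powerset, P (E \ ω) * Gn (E \ ω) = ∑ ω ∈ E.powerset, P ω * Gn ω :=
      sum_powerset_sdiff E (fun ω => P ω * Gn ω)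
    have e3 : ∑ ω ∈ E.powerset, P (E \ ω) * Gn ω = ∑ ω ∈ E.powerset, P ω * Gn (E \ ω) := by
      rw [← sum_powerset_sdiff E (fun ω => P ω * Gn (E \ ω))]
      refine Finset.sum_congr rfl fun ω hω => ?_
      rw [Finset.sdiff_sdiff_eq_self (Finset.mem_powerset.mp hω)]
    rw [e1, e2, e3] at key
    linarith
  -- (2) pointwise lower bound on the wall event: the two red clusters are disjoint there
  have h2 : ∀ ω ∈ D, -(P ω * Gn (E \ ω)) ≤
      f (C ω a) * (g (C ω a) - g (C (E \ ω) b)) + f (C ω b) * (g (C ω b) - g (C (E \ ω) a)) := by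
    intro ω hω
    rw [hD, Finset.mem_filter] at hω
    obtain ⟨-, hbR, -⟩ := hω
    have hdisj : C ω a ∩ C ω b = ∅ := by
      ext y
      simp only [Set.mem_inter_iff, Set.mem_empty_iff_false, iff_false, not_and]
      intro hya hyb
      exact hbR (SimpleGraph.Reachable.trans hya (SimpleGraph.Reachable.symm hyb))
    have hsum : f (C ω a) + f (C ω b) ≤ P ω := by
      have := hfs (C ω a) (C ω b)
      rw [hdisj, hf0, add_zero] at this
      exact this
    have ga : -(Gn (E \ ω)) ≤ g (C ω a) - g (C (E \ ω) b) := by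
      simp only [hGn]
      have u1 : g ∅ ≤ g (C ω a) := hg (Set.empty_subset _)
      have u2 : g (C (E \ ω) b) ≤ g (C (E \ ω) a ∪ C (E \ ω) b) := hg Set.subset_union_right
      linarith
    have gb : -(Gn (E \ ω)) ≤ g (C ω b) - g (C (E \ ω) a) := by
      simp only [hGn]
      have u1 : g ∅ ≤ g (C ω b) := hg (Set.empty_subset _)
      have u2 : g (C (E \ ω) a) ≤ g (C (E \ ω) a ∪ C (E \ ω) b) := hg Set.subset_union_left
      linarith
    have t1 : f (C ω a) * (-(Gn (E \ ω))) ≤ f (C ω a) * (g (C ω a) - g (C (E \ ω) b)) :=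
      mul_le_mul_of_nonneg_left ga (hf_nonneg _)
    have t2 : f (C ω b) * (-(Gn (E \ ω))) ≤ f (C ω b) * (g (C ω b) - g (C (E \ ω) a)) :=
      mul_le_mul_of_nonneg_left gb (hf_nonneg _)
    have t3 : P ω * Gn (E \ ω) ≥ (f (C ω a) + f (C ω b)) * Gn (E \ ω) := mul_le_mul_of_nonneg_right hsum (hG0 _)
    nlinarith
  -- (3) assemble
  have h3 : -(∑ ω ∈ E.powerset, P ω * Gn (E \ ω)) ≤
      ∑ ω ∈ D, (f (C ω a) * (g (C ω a) - g (C (E \ ω) b)) + f (C ω b) * (g (C ω b) - g (C (E \ ω) a))) := by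
    have hDsub : D ⊆ E.powerset := Finset.filter_subset _ _
    have s1 : ∑ ω ∈ D, P ω * Gn (E \ ω) ≤ ∑ ω ∈ E.powerset, P ω * Gn (E \ ω) :=
      Finset.sum_le_sum_of_subset_of_nonneg hDsub (fun ω _ _ => mul_nonneg (hP0 ω) (hG0 _))
    have s2 : ∑ ω ∈ D, -(P ω * Gn (E \ ω)) ≤
        ∑ ω ∈ D, (f (C ω a) * (g (C ω a) - g (C (E \ ω) b)) + f (C ω b) * (g (C ω b) - g (C (E \ ω) a))) :=
      Finset.sum_le_sum h2
    rw [Finset.sum_neg_distrib] at s2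
    linarith
  linarith

end Coefficientwise

end Summit.CriticalPhenomena.PercolationContinuityZ3.Theorems
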